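import Mathlib.RepresentationTheory.Homological.TateCohomology.Basic
import Literature.Algebra.Homology.GroupCohomologyRetract
import Mathlib.CategoryTheory.Preadditive.Biproducts
import HarnessLib

/-!
# Group cohomology and Tate cohomology commute with finite direct sums:
# `Hⁿ(G, A ⊕ B) ≅ Hⁿ(G, A) ⊕ Hⁿ(G, B)`, `Ĥⁿ(G, A ⊕ B) ≅ Ĥⁿ(G, A) ⊕ Ĥⁿ(G, B)` (Brown III §6 Ex. / Serre VII §2)

Topic `Algebra/Homology`; namespace `Literature.Algebra.Homology.GroupCohomologyBiprod`.  Mathlib plus the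
tree's `GroupCohomologyRetract.map_id_add`; the additivity of Mathlib's functors `groupCohomology.functor k G n`
and `tateCohomologyFunctor n` (both are `(co)chain-complex functor ⋙ homologyFunctor`, each additive, but the
composite `def`s carry no `Additive` instance at the pin; private copies of the first exist in
`UnramifiedCohomologySplitting` / `RestrictionCorestrictionNorm`), stated as THEOREMS (no instance is
registered), and the resulting comparison
isomorphisms with binary and finite biproducts (`Functor.mapBiprod`, `Functor.mapBiproduct`, through
Mathlib's `preservesFiniteBiproductsOfAdditive`).  Written for the idèle decomposition of class field
theory (Tate, Cassels–Fröhlich VII §7.3: `Hⁿ(G, J_{L,S}) ≅ ∏_{v ∈ S} Hⁿ(G, ∏_{w∣v} L_wˣ) × …`, a finite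
product of semi-local factors), where the `G`-module is a finite direct sum of the semi-local modules of
`Literature/NumberTheory/GaloisRepresentations/SemiLocal*Shapiro.lean`.

## What is formalised (`k` a commutative ring, `G` a group; `[Fintype G]` for Tate cohomology)

* `functor_additive n : (groupCohomology.functor k G n).Additive`, `tateCohomologyFunctor_additive n`;
  `hasFiniteBiproducts_rep : HasFiniteBiproducts (Rep k G)` (a theorem to `haveI`).
* `preservesBinaryBiproducts_functor`, **`biprodIso A B n : Hⁿ(G, A ⊞ B) ≅ Hⁿ(G, A) ⊞ Hⁿ(G, B)`**,
  `isZero_groupCohomology_biprod_iff`; `biproductIso A n : Hⁿ(G, ⨁ A) ≅ ⨁ⱼ Hⁿ(G, A j)` (finite `J`, for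
  any `HasBiproduct` structures).
* **`tateBiprodIso A B n : Ĥⁿ(G, A ⊞ B) ≅ Ĥⁿ(G, A) ⊞ Ĥⁿ(G, B)`**, `isZero_tateCohomology_biprod_iff`.

## References
* K. S. Brown, *Cohomology of Groups*, GTM 87 (1982), III §6 (additivity of `H^*(G, –)` in the coefficients).
  [Brown1982CohomologyGroups]
* J. W. S. Cassels, A. Fröhlich (eds.), *Algebraic Number Theory* (1967), Ch. VII (Tate) §7.3 (the
  application). [CasselsFrohlichANT1967]
-/

noncomputable section

open CategoryTheory CategoryTheory.Limits groupCohomology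

universe u

namespace Literature.Algebra.Homology

namespace GroupCohomologyBiprod

variable {k G : Type u} [CommRing k] [Group G]

/-- **`A ↦ Hⁿ(G, A)` is an additive functor** (the tree's `map_id_add` of `GroupCohomologyRetract`,
packaged as the `Functor.Additive` structure Mathlib's biproduct-comparison API consumes; a theorem,
not an instance). [cite: Brown1982CohomologyGroups, III §6] -/
theorem functor_additive (n : ℕ) : (groupCohomology.functor k G n).Additive where
  map_add {_ _ f g} := map_id_add f g n

/-- **`A ↦ Ĥⁿ(G, A)` is an additive functor** (`tateComplexFunctor ⋙ homologyFunctor`).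
[cite: Brown1982CohomologyGroups, VI §4] -/
theorem tateCohomologyFunctor_additive [Fintype G] (n : ℤ) :
    (tateCohomologyFunctor (R := k) (G := G) n).Additive :=
  inferInstanceAs ((tateComplexFunctor k G ⋙ HomologicalComplex.homologyFunctor _ _ n).Additive)

/-- `Rep k G` has finite biproducts (it has finite products and is preadditive); a theorem to `haveI`.
[cite: Brown1982CohomologyGroups, III §6] -/
theorem hasFiniteBiproducts_rep : HasFiniteBiproducts (Rep.{u} k G) :=
  HasFiniteBiproducts.of_hasFiniteProducts

/-- `Hⁿ(G, –)` preserves binary biproducts. [cite: Brown1982CohomologyGroups, III §6] -/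
theorem preservesBinaryBiproducts_functor (n : ℕ) :
    PreservesBinaryBiproducts (groupCohomology.functor k G n) :=
  haveI := functor_additive (k := k) (G := G) n
  preservesBinaryBiproducts_of_preservesBiproducts _

/-- **`Hⁿ(G, A ⊕ B) ≅ Hⁿ(G, A) ⊕ Hⁿ(G, B)`.** [cite: Brown1982CohomologyGroups, III §6] -/
def biprodIso (A B : Rep k G) (n : ℕ) :
    groupCohomology (A ⊞ B) n ≅ groupCohomology A n ⊞ groupCohomology B n :=
  haveI := preservesBinaryBiproducts_functor (k := k) (G := G) n
  (groupCohomology.functor k G n).mapBiprod A B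

/-- `Hⁿ(G, A ⊕ B) = 0 ↔ Hⁿ(G, A) = 0 ∧ Hⁿ(G, B) = 0`. [cite: Brown1982CohomologyGroups, III §6] -/
theorem isZero_groupCohomology_biprod_iff (A B : Rep k G) (n : ℕ) :
    IsZero (groupCohomology (A ⊞ B) n) ↔ IsZero (groupCohomology A n) ∧ IsZero (groupCohomology B n) := by
  rw [← Limits.biprod_isZero_iff]
  exact ⟨fun h => h.of_iso (biprodIso A B n).symm, fun h => h.of_iso (biprodIso A B n)⟩

/-- **`Hⁿ(G, ⨁ⱼ Aⱼ) ≅ ⨁ⱼ Hⁿ(G, Aⱼ)`** for a finite family (any `HasBiproduct` structures, e.g. from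
`hasFiniteBiproducts_rep` and Mathlib's finite biproducts of modules). [cite: Brown1982CohomologyGroups, III §6] -/
def biproductIso {J : Type} [Finite J] (A : J → Rep k G) [HasBiproduct A] (n : ℕ)
    [HasBiproduct fun j => groupCohomology (A j) n] :
    groupCohomology (⨁ A) n ≅ ⨁ fun j => groupCohomology (A j) n :=
  haveI := functor_additive (k := k) (G := G) n
  (groupCohomology.functor k G n).mapBiproduct A

/-- **`Ĥⁿ(G, A ⊕ B) ≅ Ĥⁿ(G, A) ⊕ Ĥⁿ(G, B)`.** [cite: Brown1982CohomologyGroups, VI §4] -/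
def tateBiprodIso [Fintype G] (A B : Rep k G) (n : ℤ) :
    tateCohomology (A ⊞ B) n ≅ tateCohomology A n ⊞ tateCohomology B n :=
  haveI := tateCohomologyFunctor_additive (k := k) (G := G) n
  haveI : PreservesBinaryBiproducts (tateCohomologyFunctor (R := k) (G := G) n) :=
    preservesBinaryBiproducts_of_preservesBiproducts _
  (tateCohomologyFunctor (R := k) (G := G) n).mapBiprod A B

/-- `Ĥⁿ(G, A ⊕ B) = 0 ↔ Ĥⁿ(G, A) = 0 ∧ Ĥⁿ(G, B) = 0`. [cite: Brown1982CohomologyGroups, VI §4] -/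
theorem isZero_tateCohomology_biprod_iff [Fintype G] (A B : Rep k G) (n : ℤ) :
    IsZero (tateCohomology (A ⊞ B) n) ↔ IsZero (tateCohomology A n) ∧ IsZero (tateCohomology B n) := by
  rw [← Limits.biprod_isZero_iff]
  exact ⟨fun h => h.of_iso (tateBiprodIso A B n).symm, fun h => h.of_iso (tateBiprodIso A B n)⟩

end GroupCohomologyBiprod

end Literature.Algebra.Homology

end
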